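import Literature.NumberTheory.EllipticCurves.FormalGroupInvariantDifferentialProofs
import HarnessLib

/-!
# The formal logarithm of a Weierstrass curve is a homomorphism `Ê → 𝔾̂ₐ`
(Silverman AEC IV.4.2 + IV.5.2 for `Ê`; proofs only)

Trunk T-NT-EC (Literature/NumberTheory/EllipticCurves). For a Weierstrass curve `V` over a
`ℚ`-algebra `A` whose chord–tangent formal group law `F = formalGroupLaw V` (AEC IV.1,
`FormalGroupLaw.lean`) is associative, the tree's formal logarithm `log_V = ∫ ω`
(`formalLog`, AEC IV.5, with `ω = dx/(2y + a₁x + a₃)` expanded in `z`, `formalOmega`) satisfies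

  `log_V(F(z₁, z₂)) = log_V(z₁) + log_V(z₂)` in `A⟦z₁, z₂⟧` (`formalLog_subst_formalGroupLaw_of_assoc`).

This is AEC IV.5.2 for `Ê`, including the identification (AEC IV.4.2/IV.1, proved in
`FormalGroupInvariantDifferentialProofs.lean`: `F_X(0, T) = η = (ω/dT)⁻¹`) of the normalised
invariant differential of `Ê` with the curve's `ω`. The argument is Silverman's:

1. `pderiv_formalGroupLaw_mul_formalEta` — **AEC IV.4.2 (invariance)**: differentiating the
   associativity `F(F(U, T), S) = F(U, F(T, S))` in `U` (chain rule,
   `MvPowerSeriesChainRule.lean`) and setting `U = 0` gives `F_X(T, S) · η(T) = η(F(T, S))`,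
   i.e. `ω(F(T, S)) F_X(T, S) = ω(T)` for `ω = η⁻¹ dT`;
2. `pderiv_formalLogDefect_eq_zero` — hence `∂/∂T [log(F(T, S)) - log T - log S] = 0`
   (AEC IV.5.2: "integrating … `log F(T, S) = log T + C(S)`");
3. `formalLog_subst_formalGroupLaw_of_assoc` — and the `T`-free part vanishes because
   `F(0, S) = S` (`FormalGroupNegProofs.lean`), so `C(S) = log S`.

Associativity is supplied by the caller (the tree has it for `p`-integral equations over `ℚ_p`,
`formalGroupLaw_assoc`); no named fact is introduced or used.

## Sources

* J. H. Silverman, *The Arithmetic of Elliptic Curves*, 2nd ed. (2009): IV.4.2, IV.5.2, IV.6.4(a)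
  (`SilvermanAEC2009`).
-/

noncomputable section

open PowerSeries Literature.NumberTheory.EllipticCurves
open Literature.AlgebraicGeometry.Resolution (MvPowerSeries.pderiv MvPowerSeries.coeff_pderiv
  MvPowerSeries.pderiv_X MvPowerSeries.pderiv_C MvPowerSeries.pderiv_powerSeries_subst
  MvPowerSeries.pderiv_powerSeries_subst_X MvPowerSeries.pderiv_subst_pair)

namespace WeierstrassCurve

/-! ### Generic substitution bookkeeping -/

section Subst

variable {R : Type*} [CommRing R] (W : WeierstrassCurve R)

/-- `g(0, b) = (g(0, T))(b)`: substituting `![0, b]` factors through setting `z₁ = 0`. [folklore] -/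
theorem _root_.Literature.NumberTheory.EllipticCurves.subst_zero_pair_eq {τ : Type*}
    {b : MvPowerSeries τ R} (hb : PowerSeries.HasSubst b) (g : MvPowerSeries (Fin 2) R) :
    MvPowerSeries.subst ![0, b] g =
      PowerSeries.subst b (MvPowerSeries.subst ![(0 : R⟦X⟧), PowerSeries.X] g) := by
  rw [PowerSeries.subst_def, MvPowerSeries.subst_comp_subst_apply hasSubst_zero_X hb.const]
  congr 1
  funext i
  fin_cases i
  · show (0 : MvPowerSeries τ R) = MvPowerSeries.subst (fun _ : Unit => b) (0 : R⟦X⟧)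
    rw [← MvPowerSeries.coe_substAlgHom hb.const, map_zero]
  · exact (MvPowerSeries.subst_X hb.const ()).symm

/-- The substitution `Y₀ ↦ 0`, `Y₁ ↦ X₀`, `Y₂ ↦ X₁` from three to two variables is admissible.
[folklore] -/
theorem _root_.Literature.NumberTheory.EllipticCurves.hasSubst_zero_X_X :
    MvPowerSeries.HasSubst ![(0 : MvPowerSeries (Fin 2) R), MvPowerSeries.X 0, MvPowerSeries.X 1] :=
  MvPowerSeries.hasSubst_of_constantCoeff_zero fun i => by fin_cases i <;> simp

/-- `F(Yᵢ, Yⱼ)` has no constant term. [folklore] -/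
theorem constantCoeff_formalGroupLaw_subst_X_pair {σ : Type*} (i j : σ) :
    MvPowerSeries.constantCoeff (MvPowerSeries.subst
      ![(MvPowerSeries.X i : MvPowerSeries σ R), MvPowerSeries.X j] W.formalGroupLaw) = 0 :=
  MvPowerSeries.constantCoeff_subst_eq_zero MvPowerSeries.HasSubst.X_X
    (fun k => by fin_cases k <;> exact MvPowerSeries.constantCoeff_X _) W.constantCoeff_formalGroupLaw

/-- Substituting the variables themselves is the identity. [folklore] -/
theorem _root_.Literature.NumberTheory.EllipticCurves.subst_X_zero_X_one (g : MvPowerSeries (Fin 2) R) :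
    MvPowerSeries.subst ![(MvPowerSeries.X 0 : MvPowerSeries (Fin 2) R), MvPowerSeries.X 1] g = g := by
  have : (![(MvPowerSeries.X 0 : MvPowerSeries (Fin 2) R), MvPowerSeries.X 1]) = MvPowerSeries.X := by
    funext i; fin_cases i <;> rfl
  rw [this, MvPowerSeries.subst_self]; rfl

end Subst

/-! ### AEC IV.4.2: invariance of `η⁻¹ dT` under the formal group law -/

section Invariance

variable {R : Type*} [CommRing R] (W : WeierstrassCurve R)

/-- **AEC IV.4.2 for `Ê` (invariance of the normalised differential)**: if the chord–tangent law
`F` is associative, then `F_X(z₁, z₂) · η(z₁) = η(F(z₁, z₂))` in `R⟦z₁, z₂⟧`, where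
`η = F_X(0, T) = (ω/dT)⁻¹` (`subst_zero_X_pderiv_formalGroupLaw`); i.e. `ω(F(T,S)) F_X(T,S) = ω(T)`.
Proof as printed: differentiate `F(F(U,T),S) = F(U,F(T,S))` with respect to `U` by the chain
rule and put `U = 0`, using `F(0, T) = T`. [Silverman AEC IV.4.2] [cite: SilvermanAEC2009, IV.4.2] -/
theorem pderiv_formalGroupLaw_mul_formalEta
    (hassoc : MvPowerSeries.subst ![MvPowerSeries.subst ![(MvPowerSeries.X 0 : MvPowerSeries (Fin 3) R),
        MvPowerSeries.X 1] W.formalGroupLaw, MvPowerSeries.X 2] W.formalGroupLaw =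
      MvPowerSeries.subst ![(MvPowerSeries.X 0 : MvPowerSeries (Fin 3) R),
        MvPowerSeries.subst ![(MvPowerSeries.X 1 : MvPowerSeries (Fin 3) R), MvPowerSeries.X 2]
          W.formalGroupLaw] W.formalGroupLaw) :
    MvPowerSeries.pderiv 0 W.formalGroupLaw *
        W.formalEta.subst (MvPowerSeries.X 0 : MvPowerSeries (Fin 2) R) =
      W.formalEta.subst W.formalGroupLaw := by
  classical
  set F := W.formalGroupLaw with hF
  set A₁ : MvPowerSeries (Fin 3) R :=
    MvPowerSeries.subst ![(MvPowerSeries.X 0 : MvPowerSeries (Fin 3) R), MvPowerSeries.X 1] F with hA₁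
  set B₁ : MvPowerSeries (Fin 3) R :=
    MvPowerSeries.subst ![(MvPowerSeries.X 1 : MvPowerSeries (Fin 3) R), MvPowerSeries.X 2] F with hB₁
  have hA₀ : MvPowerSeries.constantCoeff A₁ = 0 := W.constantCoeff_formalGroupLaw_subst_X_pair 0 1
  have hB₀ : MvPowerSeries.constantCoeff B₁ = 0 := W.constantCoeff_formalGroupLaw_subst_X_pair 1 2
  have hX : ∀ i : Fin 3, MvPowerSeries.constantCoeff (MvPowerSeries.X i : MvPowerSeries (Fin 3) R) = 0 :=
    fun i => MvPowerSeries.constantCoeff_X i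
  -- (1) differentiate the associativity with respect to `Y₀`
  have hd := congrArg (MvPowerSeries.pderiv (0 : Fin 3)) hassoc
  rw [MvPowerSeries.pderiv_subst_pair hA₀ (hX 2), MvPowerSeries.pderiv_subst_pair (hX 0) hB₀,
    hA₁, MvPowerSeries.pderiv_subst_pair (hX 0) (hX 1), hB₁,
    MvPowerSeries.pderiv_subst_pair (hX 1) (hX 2)] at hd
  simp only [MvPowerSeries.pderiv_X, if_pos, show ((1 : Fin 3) = 0) = False by decide,
    show ((2 : Fin 3) = 0) = False by decide, if_false, mul_zero, mul_one, add_zero] at hd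
  -- hd : subst ![A₁, Y₂] (∂₀F) * subst ![Y₀, Y₁] (∂₀F) = subst ![Y₀, B₁] (∂₀F)
  -- (2) put `Y₀ = 0`, `Y₁ = X₀`, `Y₂ = X₁`
  have hT := hasSubst_zero_X_X (R := R)
  have hTX : ∀ i : Fin 3, MvPowerSeries.subst ![(0 : MvPowerSeries (Fin 2) R), MvPowerSeries.X 0,
      MvPowerSeries.X 1] (MvPowerSeries.X i : MvPowerSeries (Fin 3) R) =
      (![(0 : MvPowerSeries (Fin 2) R), MvPowerSeries.X 0, MvPowerSeries.X 1]) i :=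
    fun i => MvPowerSeries.subst_X hT i
  have hTA : MvPowerSeries.subst ![(0 : MvPowerSeries (Fin 2) R), MvPowerSeries.X 0, MvPowerSeries.X 1] A₁ =
      MvPowerSeries.X 0 := by
    rw [hA₁, MvPowerSeries.subst_comp_subst_apply (MvPowerSeries.HasSubst.X_X (i := 0) (j := 1)) hT]
    have : (fun s => MvPowerSeries.subst ![(0 : MvPowerSeries (Fin 2) R), MvPowerSeries.X 0,
        MvPowerSeries.X 1] ((![(MvPowerSeries.X 0 : MvPowerSeries (Fin 3) R), MvPowerSeries.X 1]) s)) =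
        ![(0 : MvPowerSeries (Fin 2) R), MvPowerSeries.X 0] := by
      funext s; fin_cases s
      · exact hTX 0
      · exact hTX 1
    rw [this, hF, W.formalGroupLaw_subst_zero (PowerSeries.HasSubst.X 0)]
  have hTB : MvPowerSeries.subst ![(0 : MvPowerSeries (Fin 2) R), MvPowerSeries.X 0, MvPowerSeries.X 1] B₁ =
      F := by
    rw [hB₁, MvPowerSeries.subst_comp_subst_apply (MvPowerSeries.HasSubst.X_X (i := 1) (j := 2)) hT]
    have : (fun s => MvPowerSeries.subst ![(0 : MvPowerSeries (Fin 2) R), MvPowerSeries.X 0,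
        MvPowerSeries.X 1] ((![(MvPowerSeries.X 1 : MvPowerSeries (Fin 3) R), MvPowerSeries.X 2]) s)) =
        ![(MvPowerSeries.X 0 : MvPowerSeries (Fin 2) R), MvPowerSeries.X 1] := by
      funext s; fin_cases s
      · exact hTX 1
      · exact hTX 2
    rw [this, subst_X_zero_X_one]
  have key := congrArg (MvPowerSeries.subst ![(0 : MvPowerSeries (Fin 2) R), MvPowerSeries.X 0,
    MvPowerSeries.X 1]) hd
  rw [MvPowerSeries.subst_mul hT,
    MvPowerSeries.subst_comp_subst_apply (MvPowerSeries.hasSubst_of_constantCoeff_zero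
      (fun i => by fin_cases i; exacts [hA₀, hX 2])) hT,
    MvPowerSeries.subst_comp_subst_apply (MvPowerSeries.HasSubst.X_X (i := 0) (j := 1)) hT,
    MvPowerSeries.subst_comp_subst_apply (MvPowerSeries.hasSubst_of_constantCoeff_zero
      (fun i => by fin_cases i; exacts [hX 0, hB₀])) hT] at key
  have e1 : (fun s => MvPowerSeries.subst ![(0 : MvPowerSeries (Fin 2) R), MvPowerSeries.X 0,
      MvPowerSeries.X 1] ((![A₁, MvPowerSeries.X 2]) s)) =
      ![(MvPowerSeries.X 0 : MvPowerSeries (Fin 2) R), MvPowerSeries.X 1] := by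
    funext s; fin_cases s
    · exact hTA
    · exact hTX 2
  have e2 : (fun s => MvPowerSeries.subst ![(0 : MvPowerSeries (Fin 2) R), MvPowerSeries.X 0,
      MvPowerSeries.X 1] ((![(MvPowerSeries.X 0 : MvPowerSeries (Fin 3) R), MvPowerSeries.X 1]) s)) =
      ![(0 : MvPowerSeries (Fin 2) R), MvPowerSeries.X 0] := by
    funext s; fin_cases s
    · exact hTX 0
    · exact hTX 1
  have e3 : (fun s => MvPowerSeries.subst ![(0 : MvPowerSeries (Fin 2) R), MvPowerSeries.X 0,
      MvPowerSeries.X 1] ((![(MvPowerSeries.X 0 : MvPowerSeries (Fin 3) R), B₁]) s)) =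
      ![(0 : MvPowerSeries (Fin 2) R), F] := by
    funext s; fin_cases s
    · exact hTX 0
    · exact hTB
  rw [e1, e2, e3, subst_X_zero_X_one, subst_zero_pair_eq (PowerSeries.HasSubst.X 0),
    subst_zero_pair_eq W.hasSubst_formalGroupLaw, hF, W.subst_zero_X_pderiv_formalGroupLaw] at key
  rw [hF]
  exact key

end Invariance

/-! ### AEC IV.5.2: `log(F(z₁, z₂)) = log z₁ + log z₂` -/

section LogHom

variable {A : Type*} [CommRing A] [Algebra ℚ A] (V : WeierstrassCurve A)

/-- **`d(log_V)/dT = ω/dT`**: the formal logarithm is the termwise integral of `formalOmega`.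
[Silverman AEC IV.5 (definition of `log_F = ∫ω`)] [folklore] -/
theorem derivative_formalLog : d⁄dX A V.formalLog = V.formalOmega := by
  ext n
  rw [coeff_derivative]
  rcases n with _ | n
  · simp [coeff_zero_eq_constantCoeff, V.constantCoeff_formalOmega]
  · rw [formalLog, coeff_mk]
    dsimp only
    have h : (algebraMap ℚ A) (1 / (n + 2 : ℚ)) * ((n + 1 : ℕ) + 1 : A) = 1 := by
      have h2 : ((n + 1 : ℕ) + 1 : A) = algebraMap ℚ A (n + 2 : ℚ) := by
        rw [map_add, map_natCast, map_ofNat]; push_cast; ring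
      rw [h2, ← map_mul, one_div_mul_cancel (by positivity), map_one]
    calc (algebraMap ℚ A) (1 / (n + 2 : ℚ)) * coeff (n + 1) V.formalOmega * ((n + 1 : ℕ) + 1 : A)
        = ((algebraMap ℚ A) (1 / (n + 2 : ℚ)) * ((n + 1 : ℕ) + 1 : A)) * coeff (n + 1) V.formalOmega := by
          ring
      _ = coeff (n + 1) V.formalOmega := by rw [h, one_mul]

/-- Over a `ℚ`-algebra, `∂₀ g = 0` kills every coefficient of positive `X₀`-degree. [folklore] -/
theorem _root_.Literature.NumberTheory.EllipticCurves.coeff_eq_zero_of_pderiv_eq_zero_of_algebra_rat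
    {σ : Type*} {i : σ} {g : MvPowerSeries σ A} (h : MvPowerSeries.pderiv i g = 0) {e : σ →₀ ℕ}
    (he : e i ≠ 0) : MvPowerSeries.coeff e g = 0 := by
  classical
  set e' := e - Finsupp.single i 1 with he'
  have hee : e' + Finsupp.single i 1 = e := by
    rw [he']
    exact tsub_add_cancel_of_le (Finsupp.single_le_iff.mpr (Nat.one_le_iff_ne_zero.mpr he))
  have hc := congrArg (MvPowerSeries.coeff e') h
  rw [MvPowerSeries.coeff_pderiv, map_zero, hee] at hc
  have hn : ((e' i : A) + 1) = algebraMap ℚ A (e' i + 1 : ℚ) := by push_cast; ring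
  rw [hn] at hc
  have := congrArg (fun x => algebraMap ℚ A (1 / (e' i + 1 : ℚ)) * x) hc
  simp only [mul_zero, ← mul_assoc, ← map_mul] at this
  rwa [one_div_mul_cancel (by positivity), map_one, one_mul] at this

/-- **AEC IV.5.2, differentiated form**: if `F` is associative then
`∂/∂z₁ [log(F(z₁,z₂)) - log z₁ - log z₂] = ω(F)·F_X - ω(z₁) = 0` (by invariance, `ω = η⁻¹dT`).
[Silverman AEC IV.5.2, proof] [cite: SilvermanAEC2009, IV.5.2] -/
theorem pderiv_formalLogDefect_eq_zero
    (hassoc : MvPowerSeries.subst ![MvPowerSeries.subst ![(MvPowerSeries.X 0 : MvPowerSeries (Fin 3) A),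
        MvPowerSeries.X 1] V.formalGroupLaw, MvPowerSeries.X 2] V.formalGroupLaw =
      MvPowerSeries.subst ![(MvPowerSeries.X 0 : MvPowerSeries (Fin 3) A),
        MvPowerSeries.subst ![(MvPowerSeries.X 1 : MvPowerSeries (Fin 3) A), MvPowerSeries.X 2]
          V.formalGroupLaw] V.formalGroupLaw) :
    MvPowerSeries.pderiv 0 (V.formalLog.subst V.formalGroupLaw -
      V.formalLog.subst (MvPowerSeries.X 0 : MvPowerSeries (Fin 2) A) -
      V.formalLog.subst (MvPowerSeries.X 1 : MvPowerSeries (Fin 2) A)) = 0 := by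
  classical
  have hinv := V.pderiv_formalGroupLaw_mul_formalEta hassoc
  have hωη : V.formalOmega * V.formalEta = 1 := V.formalOmega_mul_formalEta
  have hF0 : MvPowerSeries.constantCoeff V.formalGroupLaw = 0 := V.constantCoeff_formalGroupLaw
  have hsF := V.hasSubst_formalGroupLaw
  -- the derivative of the defect
  have hd : MvPowerSeries.pderiv 0 (V.formalLog.subst V.formalGroupLaw -
      V.formalLog.subst (MvPowerSeries.X 0 : MvPowerSeries (Fin 2) A) -
      V.formalLog.subst (MvPowerSeries.X 1 : MvPowerSeries (Fin 2) A)) =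
      V.formalOmega.subst V.formalGroupLaw * MvPowerSeries.pderiv 0 V.formalGroupLaw -
        V.formalOmega.subst (MvPowerSeries.X 0 : MvPowerSeries (Fin 2) A) := by
    rw [map_sub, map_sub, MvPowerSeries.pderiv_powerSeries_subst hF0, MvPowerSeries.pderiv_powerSeries_subst_X,
      MvPowerSeries.pderiv_powerSeries_subst_X, if_pos rfl, if_neg (by decide), sub_zero,
      V.derivative_formalLog]
  -- multiply by the unit `η(z₁)`
  have hc : MvPowerSeries.constantCoeff (V.formalEta.subst (MvPowerSeries.X 0 : MvPowerSeries (Fin 2) A)) = 1 := by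
    rw [← MvPowerSeries.coeff_zero_eq_constantCoeff_apply, coeff_powerSeries_subst_X]
    simp [coeff_zero_eq_constantCoeff, V.constantCoeff_formalEta]
  have hu : IsUnit (V.formalEta.subst (MvPowerSeries.X 0 : MvPowerSeries (Fin 2) A)) := by
    rw [MvPowerSeries.isUnit_iff_constantCoeff, hc]; exact isUnit_one
  have h1F : (V.formalOmega * V.formalEta).subst V.formalGroupLaw = 1 := by
    rw [hωη, ← PowerSeries.coe_substAlgHom hsF, map_one]
  have h1X : (V.formalOmega * V.formalEta).subst (MvPowerSeries.X 0 : MvPowerSeries (Fin 2) A) = 1 := by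
    rw [hωη, ← PowerSeries.coe_substAlgHom (PowerSeries.HasSubst.X (0 : Fin 2)), map_one]
  rw [PowerSeries.subst_mul hsF] at h1F
  rw [PowerSeries.subst_mul (PowerSeries.HasSubst.X (0 : Fin 2))] at h1X
  have h0 : MvPowerSeries.pderiv 0 (V.formalLog.subst V.formalGroupLaw -
      V.formalLog.subst (MvPowerSeries.X 0 : MvPowerSeries (Fin 2) A) -
      V.formalLog.subst (MvPowerSeries.X 1 : MvPowerSeries (Fin 2) A)) *
      V.formalEta.subst (MvPowerSeries.X 0 : MvPowerSeries (Fin 2) A) = 0 := by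
    rw [hd]
    linear_combination V.formalOmega.subst V.formalGroupLaw * hinv + h1F - h1X
  exact (hu.mul_left_eq_zero).mp h0

/-- **AEC IV.5.2 for the formal group of a Weierstrass curve**: over a `ℚ`-algebra, if the
chord–tangent law `F` is associative then the formal logarithm `log = ∫ω` (`formalLog`, `ω` the
`z`-expansion of `dx/(2y + a₁x + a₃)`) is a homomorphism `Ê → 𝔾̂ₐ`:
`log(F(z₁, z₂)) = log z₁ + log z₂` in `A⟦z₁, z₂⟧` (`∂/∂z₁` of the defect vanishes, and its
`z₁`-free part is `log(F(0, z₂)) - log z₂ = 0`). [Silverman AEC IV.5.2 (with IV.4.2, IV.1)]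
[cite: SilvermanAEC2009, IV.5.2] -/
theorem formalLog_subst_formalGroupLaw_of_assoc
    (hassoc : MvPowerSeries.subst ![MvPowerSeries.subst ![(MvPowerSeries.X 0 : MvPowerSeries (Fin 3) A),
        MvPowerSeries.X 1] V.formalGroupLaw, MvPowerSeries.X 2] V.formalGroupLaw =
      MvPowerSeries.subst ![(MvPowerSeries.X 0 : MvPowerSeries (Fin 3) A),
        MvPowerSeries.subst ![(MvPowerSeries.X 1 : MvPowerSeries (Fin 3) A), MvPowerSeries.X 2]
          V.formalGroupLaw] V.formalGroupLaw) :
    V.formalLog.subst V.formalGroupLaw =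
      V.formalLog.subst (MvPowerSeries.X 0 : MvPowerSeries (Fin 2) A) +
        V.formalLog.subst (MvPowerSeries.X 1 : MvPowerSeries (Fin 2) A) := by
  classical
  have hD := V.pderiv_formalLogDefect_eq_zero hassoc
  have hsF := V.hasSubst_formalGroupLaw
  rw [← sub_eq_zero, ← sub_sub]
  ext e
  rw [MvPowerSeries.coeff_zero]
  by_cases he : e 0 = 0
  · have hes : e = Finsupp.single 1 (e 1) := by
      ext i; fin_cases i
      · simpa using he
      · simp
    have hs := hasSubst_zero_X (R := A)
    rw [hes, ← coeff_subst_zero_X, MvPowerSeries.subst_sub hs, MvPowerSeries.subst_sub hs,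
      mvSubst_powerSeries_subst hsF hs, mvSubst_powerSeries_subst (PowerSeries.HasSubst.X 0) hs,
      mvSubst_powerSeries_subst (PowerSeries.HasSubst.X 1) hs, V.formalGroupLaw_subst_zero_X,
      subst_zero_X_X_zero, subst_zero_X_X_one,
      PowerSeries.subst_zero_of_constantCoeff_zero V.constantCoeff_formalLog, sub_zero, sub_self, map_zero]
  · exact coeff_eq_zero_of_pderiv_eq_zero_of_algebra_rat hD he

end LogHom

end WeierstrassCurve
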